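import Literature.NumberTheory.EllipticCurves.CyclotomicIwasawaMainTheoremIrreducible
import Literature.NumberTheory.EllipticCurves.ModularCurvePeriodRatio
import Literature.NumberTheory.EllipticCurves.QuadraticTwist
import HarnessLib

/-!
# Burungale–Castella–Skinner 2025, proof of Thm. 1.1.2, display (5.3): the cyclotomic FOUR-FOLD
# PRODUCT divisibility `(L_p(g) L_p(g_K) L_p(g_F) L_p(g_{FK})) ⊇ ch X(g) ch X(g_K) ch X(g_F) ch X(g_{FK})`
# IN `Λ`, for the newform `g` of an elliptic curve with irreducible `E[p]` at a good ordinary `p ≥ 5`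

Source: A. Burungale, F. Castella, C. Skinner, *Base change and Iwasawa main conjectures for
`GL₂`*, Int. Math. Res. Not. IMRN 2025, no. 8, rnaf082 = arXiv:2405.00270v2 (REFEREED; bib key
`BurungaleCastellaSkinner2025`; held text `paper:arxiv-2405.00270`), §5.2 "Proof of Theorem 1.1.2",
display (5.3), p. 10 (`[corpus: paper:arxiv-2405.00270 p0010 L69–L93]`), with Lemma 5.2.3 (p. 10,
L56–L68) for the existence of the auxiliary fields. Cell `pub/bsd-print-x9` (D-0131 (2) print
tier), seat `bsd-print-x9-p1`.

## The printed statement (verbatim, p. 10)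

> *Proof of Theorem 1.1.2.* Pick an imaginary quadratic field `K` and a real quadratic field `F`
> as in Lemma 5.2.3. Then by Proposition 5.2.1,
> `(L_p^PR(g/K) · L_p^PR(g_F/K)) ⊃ ch_{Λ_K}(X_ord(g/K_∞)) · ch_{Λ_K}(X_ord(g_F/K_∞))`.   (5.2)
> By [CGS23, Prop. 1.2.4] and Propositions 3.6 and 3.9 in [SU14], taking the image under the maps
> induced by the projection `π⁺ : Γ_K ↠ Γ_K⁺`, from (5.2) we get the divisibilities
> `(L_p(g/ℚ) · L_p(g_K/ℚ) · L_p(g_F/ℚ) · L_p(g_{FK}/ℚ)) ⊃ π⁺(ch_{Λ_K}(X_ord(g/K_∞)) · ch_{Λ_K}(X_ord(g_F/K_∞)))`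
> `⊃ ch_Λ(X_ord(g/ℚ_∞)) · ch_Λ(X_ord(g_K/ℚ_∞)) · ch_Λ(X_ord(g_F/ℚ_∞)) · ch_Λ(X_ord(g_{FK}/ℚ_∞))`   (5.3)
> in `Λ_K⁺ ≃ Λ`.

Standing hypotheses of §5 (p. 9, L15–L16): "Let `g ∈ S₂(Γ₀(N))` be an elliptic newform, and
`p > 3` a good ordinary prime for `g` such that (irr_ℚ) holds"; Lemma 5.2.3 (p. 10): "Let
`g ∈ S₂(Γ₀(N))` be an elliptic newform and `p ≥ 5` a prime of good ordinary reduction for `g` such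
that `ρ̄_g` is irreducible as `G_ℚ`-representation. Then there exist an imaginary quadratic field `K`
satisfying (disc), (Heeg), (spl), and (irr_K), and a real quadratic field `F` satisfying (i)–(vi) in
Proposition 5.2.1." Here (p. 2, p. 9) (disc): `D_K` odd and `≠ -3`; (Heeg): every prime `ℓ ∣ N`
splits in `K`; (spl): `p` splits in `K`; (i) `p` inert in `F`; (ii) `D_F` odd and every prime
dividing `D_F` splits in `K`; (iii) every `ℓ ∣ N` inert in `F` if `ℓ ≡ -1 (mod p)`, split otherwise;
(vi) `p = 5 ⇒ F ≠ ℚ(ζ₅)⁺`; `g_K, g_F, g_{FK}` are the twists of `g` by the quadratic characters of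
`K, F, FK` (Lemma 5.1.1), i.e. the newforms of the quadratic twists `E^{(d_K)}, E^{(d_F)},
E^{(d_K d_F)}` of the elliptic curve `E` of `g`; `L_p(·/ℚ) ∈ Λ ⊗ ℚ_p` is "the `p`-adic `L`-function
attached to `E` by Mazur–Swinnerton-Dyer [MSD74]" (p. 1), integral under (irr_ℚ) (p. 2, [GV00,
Prop. 3.1]); `X_ord(·/ℚ_∞)` is the Pontryagin dual of the `p^∞`-Selmer group over the cyclotomic
`ℤ_p`-extension and `ch_Λ` its characteristic ideal (p. 1).

The display is INTEGRAL (in `Λ`): it is from the integral (5.3) and the integral form of Kato's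
(5.4) under (im) that the source concludes part (b) of Thm. 1.1.2 ("Noting that a proper
divisibility in (5.4) would contradict (5.3), the proof concludes", p. 10 L94–L95).

## Transcription (tree vocabulary only; nothing re-declared)

* The standing data exactly as in the tree's transcription of Thm. 1.1.2 (a),
  `Literature.NumberTheory.EllipticCurves.burungale_castella_skinner_charIdeal_eq_padicLFunction`
  (`CyclotomicIwasawaMainTheoremIrreducible.lean`): `W` a globally minimal elliptic Weierstrass
  equation of `E/ℚ`, `5 ≤ p`, good ordinary (`hgood`, `hord`), (irr_ℚ) (`hirr`), the cyclotomic
  `ℤ_p`-extension `κ` with topological generator `γ` matching the cyclotomic variable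
  (`hκ`, `hγ`, `hγ'`), `f = g` a newform of `E` of level `N` (`hf`; `N = N_E` by Carayol).
* The auxiliary fields enter the display ONLY through the three twisted curves, so the pair
  `(K, F)` is recorded by its fundamental discriminants `d_K < 0 < d_F` and the ARITHMETIC content
  of Lemma 5.2.3 / Prop. 5.2.1 that the discriminants carry — `d_K ≡ d_F ≡ 1 (mod 4)` squarefree
  ((disc), "`D_F` odd"), `d_K ≠ -3`, `(d_K, d_F) = 1` ((ii)), `(d_K d_F, pN) = 1` ((Heeg), (spl),
  (i), (iii): split or inert primes are unramified), `d_K` a square mod `p` ((spl)) and `d_F` a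
  non-square mod `p` ((i)) — EXACTLY the witness list of the tree's `Λ ⊗ ℚ_p` transcription of the
  same display, the hypothesis `h53` of
  `burungale_castella_skinner_charIdeal_eq_padicLFunction_of_baseChange_divisibility`
  (`CyclotomicIwasawaMainTheoremIrreducibleBaseChangeProofs.lean`). The Galois-theoretic conditions
  (irr_K), (iv) (irr_M), (v) have no bearing on the display's shape and are not recorded (this
  only weakens what is claimed about the witnesses). The existence quantifier `∃ d_K d_F` is
  Lemma 5.2.3 as printed.
* `g_K, g_F, g_{FK}`: ANY globally minimal models `W₁, W₂, W₃` of the twists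
  (`∃ C, C • Wᵢ = W.quadraticTwist d`, the shape of `h53` and of
  `exists_isGloballyMinimal_smul_eq_quadraticTwist`) with ANY newforms `f₁, f₂, f₃`
  (`IsNewformOf Wᵢ fᵢ`), and ANY Pontryagin-dual data `D, D₁, D₂, D₃` over `(κ, γ)`
  (`WeierstrassCurve.SelmerDualData`, whose `charIdeal` is `ch_Λ X_ord(·/ℚ_∞)`).
* `L_p(·/ℚ)` in the MAZUR–SWINNERTON-DYER normalisation of p. 1 (Néron period `Ω_{Eᵢ}` of the
  globally minimal `Wᵢ`): `𝓛_MSD(Eᵢ) = ϖᵢ · padicLFunction fᵢ (unitRoot Wᵢ p)` for the rational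
  `ϖᵢ` with `ϖᵢ · Ω_{Eᵢ} = Ω⁺_{fᵢ}` (`(ϖᵢ : ℝ) * Wᵢ.realPeriodRat = plusPeriod fᵢ`) — the tree's
  established spelling of Mazur's normalisation (`Rank1Residual.mazurMainConjecture_neron_of_mu_eq_zero`,
  route item `MuZeroCMCurves` of `SmallImageMuTransfer`); under (irr_ℚ) and `p ≥ 5` each `ϖᵢ` is a
  `p`-adic unit (Greenberg–Vatsal 2000 Rem. 3.4; tree fact `realPeriodRat_eq_unit_mul_plusPeriod`),
  which this file does NOT use or assert.
* "(5.3) in `Λ`": the product `𝓛_MSD(E) 𝓛_MSD(E₁) 𝓛_MSD(E₂) 𝓛_MSD(E₃) ∈ ℚ_p⟦T⟧` is the image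
  `ι G` of some `G ∈ Λ = ℤ_p⟦T⟧` (`ι = iwasawaToPowerSeries p`) and
  `ch X(E) · ch X(E₁) · ch X(E₂) · ch X(E₃) ≤ (G)` as ideals of `Λ`. No `p`-power slack (that is
  the difference with `h53`, which reads the display in `Λ ⊗ ℚ_p`).

With these readings the statement is the printed display for the elliptic newform `g = f_E`,
never stronger: weaker only in the witness list of Lemma 5.2.3. It is the base-change half of
Thm. 1.1.2 (Wan's `U(3,1)` divisibility over `M = FK` [Wan15, Thm. 3], Hida theory, the
`Λ`-adic comparisons [CGS23, Prop. 1.2.4] and controls [SU14, Props. 3.6, 3.9]) — none of it in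
Mathlib or the tree — and is NOT asserted: consumers take
`(h53 : display53_prod_charIdeal_le_prod_padicLFunction)`. Provenance flags of the cell registry
travel with it (row of `BurungaleCastellaSkinner2025`: `BCS25-IMC-equiv@BSTW+Wan15-Thm3@Fuj06(unpublished)+Hid04-gap`
— the comparison [CGS23, Prop. 1.2.4] of `π⁺ L_p^PR(g/K)` with `L_p(g) L_p(g_K)` involves Hida's
canonical period).

Why this display and not only Thm. 1.1.2: under (irr_ℚ) ALONE it is the whole INTEGRAL content of
the source on the cyclotomic line (Thm. 1.1.2 (a) is in `Λ ⊗ ℚ_p`; (b) needs (im)); with the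
algebraic `μ = 0` at the four curves it pins the `μ`-defect of each factor (consumer:
`Summits/BirchSwinnertonDyer/BirchSwinnertonDyer/Theorems/PrintX9GreenbergMuBridge.lean`).
-- TODO(general form): the display for an arbitrary weight-two newform `g ∈ S₂(Γ₀(N))` good
-- ordinary at `p ≥ 5` with `ρ̄_g` irreducible (coefficients in `𝒪_λ⟦Γ⟧`), and the intermediate
-- inclusion through `π⁺(ch_{Λ_K} X_ord(g/K_∞) · ch_{Λ_K} X_ord(g_F/K_∞))` (two-variable carriers
-- `XOrd₂` exist; the assembly from `BurungaleCastellaSkinner2025.prop521_baseChange_product_divisibilities`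
-- is the TODO recorded there).

## References
* [BurungaleCastellaSkinner2025] IMRN 2025 (8), rnaf082 = arXiv:2405.00270v2: display (5.3) and
  "Proof of Theorem 1.1.2" (p. 10), Lemma 5.2.3 (p. 10), Prop. 5.2.1 (pp. 9–10), (disc)/(Heeg)/(spl)
  (p. 2), p. 1 (`Λ`, `X_ord`, `L_p(E/ℚ)` of [MSD74]).
* [GreenbergVatsal2000] Invent. Math. 142: Prop. 3.1 / 3.7 (integrality), Rem. 3.4 (periods).
* [SkinnerUrban2014] Props. 3.6, 3.9; [CastellaGrossiSkinner2025] Prop. 1.2.4 (as cited in the proof).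
-/

noncomputable section

open scoped Classical

open CongruenceSubgroup WeierstrassCurve Literature.NumberTheory.EllipticCurves
  Literature.NumberTheory.EllipticCurves.ModularForms

namespace Literature.NumberTheory.EllipticCurves.BurungaleCastellaSkinner2025

/-- **Burungale–Castella–Skinner, IMRN 2025 (rnaf082) = arXiv:2405.00270v2, display (5.3) of the
proof of Thm. 1.1.2 (p. 10), with Lemma 5.2.3 — the cyclotomic four-fold product divisibility in
`Λ`.** For `E/ℚ` with globally minimal equation `W`, `p ≥ 5` a prime of good ordinary reduction
(`hgood`, `hord`) with `E[p]` an irreducible `G_ℚ`-module (`hirr`, (irr_ℚ)), the cyclotomic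
`ℤ_p`-extension `κ` with topological generator `γ` matching the cyclotomic variable (`hκ`, `hγ`,
`hγ'`) and `f` a newform of `E` of level `N` (`hf`): there are fundamental discriminants
`d_K < 0 < d_F` (of the fields `K`, `F` of Lemma 5.2.3: `d_K ≡ d_F ≡ 1 (mod 4)` squarefree,
`d_K ≠ -3`, `(d_K, d_F) = 1`, `(d_K d_F, pN) = 1`, `d_K` a square and `d_F` a non-square mod `p`)
such that for all globally minimal models `W₁, W₂, W₃` of the quadratic twists of `E` by
`d_K, d_F, d_K d_F`, all newforms `f₁, f₂, f₃` of them, all rationals `ϖ, ϖ₁, ϖ₂, ϖ₃` with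
`ϖᵢ · Ω_{Eᵢ} = Ω⁺_{fᵢ}` (Mazur–Swinnerton-Dyer normalisation `𝓛_MSD(Eᵢ) = ϖᵢ · L_p(fᵢ, αᵢ)`,
`αᵢ = unitRoot Wᵢ p`) and all Pontryagin-dual data `D, D₁, D₂, D₃` over `(κ, γ)`:
`𝓛_MSD(E) 𝓛_MSD(E₁) 𝓛_MSD(E₂) 𝓛_MSD(E₃) = ι G` for some `G ∈ Λ = ℤ_p⟦T⟧` with
`ch X(E) · ch X(E₁) · ch X(E₂) · ch X(E₃) ⊆ (G)` in `Λ` — verbatim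
"`(L_p(g/ℚ) · L_p(g_K/ℚ) · L_p(g_F/ℚ) · L_p(g_{FK}/ℚ)) ⊃ ch_Λ(X_ord(g/ℚ_∞)) · ch_Λ(X_ord(g_K/ℚ_∞)) ·
ch_Λ(X_ord(g_F/ℚ_∞)) · ch_Λ(X_ord(g_{FK}/ℚ_∞))` in `Λ_K⁺ ≃ Λ`". Module docstring for the reading of
every symbol. Not asserted; no `_holds` (Wan's divisibility, Hida theory and the `Λ`-adic
comparisons are not in the tree).
[cite: BurungaleCastellaSkinner2025, Proof of Thm. 1.1.2, display (5.3), and Lemma 5.2.3 (p. 10 of arXiv:2405.00270v2)] -/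
def display53_prod_charIdeal_le_prod_padicLFunction : Prop :=
  ∀ (W : WeierstrassCurve ℚ) [W.IsElliptic] [W.IsGloballyMinimal] (p : ℕ) [Fact p.Prime]
    (κ : ZpExtension ℚ p) (γ : Field.absoluteGaloisGroup ℚ) {N : ℕ} [NeZero N]
    (f : CuspForm (Gamma0 N) 2)
    (hp : 5 ≤ p) (hgood : W.HasGoodReductionAtPrime p) (hord : ¬ (p : ℤ) ∣ W.frobeniusTrace p)
    (hirr : W.HasIrreducibleModPGaloisRep p) (hκ : κ.IsCyclotomic) (hγ : κ.IsTopGenerator γ)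
    (hγ' : IsCyclotomicVariable p γ) (hf : IsNewformOf W f),
    ∃ dK dF : ℤ,
      dK < 0 ∧ dK % 4 = 1 ∧ Squarefree dK ∧ dK ≠ -3 ∧
      1 < dF ∧ dF % 4 = 1 ∧ Squarefree dF ∧ IsCoprime dK dF ∧
      IsCoprime (dK * dF) (p * N) ∧
      IsSquare ((dK : ZMod p)) ∧ ¬ IsSquare ((dF : ZMod p)) ∧
      ∀ (W₁ W₂ W₃ : WeierstrassCurve ℚ) [W₁.IsElliptic] [W₁.IsGloballyMinimal]
        [W₂.IsElliptic] [W₂.IsGloballyMinimal] [W₃.IsElliptic] [W₃.IsGloballyMinimal]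
        (h₁ : ∃ C : VariableChange ℚ, C • W₁ = W.quadraticTwist (dK : ℚ))
        (h₂ : ∃ C : VariableChange ℚ, C • W₂ = W.quadraticTwist (dF : ℚ))
        (h₃ : ∃ C : VariableChange ℚ, C • W₃ = W.quadraticTwist ((dK * dF : ℤ) : ℚ))
        {N₁ N₂ N₃ : ℕ} [NeZero N₁] [NeZero N₂] [NeZero N₃]
        (f₁ : CuspForm (Gamma0 N₁) 2) (f₂ : CuspForm (Gamma0 N₂) 2)
        (f₃ : CuspForm (Gamma0 N₃) 2)
        (hf₁ : IsNewformOf W₁ f₁) (hf₂ : IsNewformOf W₂ f₂) (hf₃ : IsNewformOf W₃ f₃)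
        (ϖ ϖ₁ ϖ₂ ϖ₃ : ℚ)
        (hϖ : (ϖ : ℝ) * W.realPeriodRat = plusPeriod f)
        (hϖ₁ : (ϖ₁ : ℝ) * W₁.realPeriodRat = plusPeriod f₁)
        (hϖ₂ : (ϖ₂ : ℝ) * W₂.realPeriodRat = plusPeriod f₂)
        (hϖ₃ : (ϖ₃ : ℝ) * W₃.realPeriodRat = plusPeriod f₃)
        (D : W.SelmerDualData κ γ) (D₁ : W₁.SelmerDualData κ γ) (D₂ : W₂.SelmerDualData κ γ)
        (D₃ : W₃.SelmerDualData κ γ),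
        ∃ G : IwasawaAlgebra p,
          iwasawaToPowerSeries p G =
              (PowerSeries.C (ϖ : ℚ_[p]) * padicLFunction f (unitRoot W p : ℚ_[p])) *
              (PowerSeries.C (ϖ₁ : ℚ_[p]) * padicLFunction f₁ (unitRoot W₁ p : ℚ_[p])) *
              (PowerSeries.C (ϖ₂ : ℚ_[p]) * padicLFunction f₂ (unitRoot W₂ p : ℚ_[p])) *
              (PowerSeries.C (ϖ₃ : ℚ_[p]) * padicLFunction f₃ (unitRoot W₃ p : ℚ_[p])) ∧
          D.charIdeal * D₁.charIdeal * D₂.charIdeal * D₃.charIdeal ≤ Ideal.span {G}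

end Literature.NumberTheory.EllipticCurves.BurungaleCastellaSkinner2025

end
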